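import Literature.NumberTheory.NumberFields.AmbiguousClassNumberFormula
import Literature.NumberTheory.NumberFields.ClassGroupNormGalois
import Literature.NumberTheory.QuadraticForms.NormModFour
import HarnessLib

/-!
# Ambiguous classes of totally complex cyclic fields; Gauss's genus count `#Cl(K)[2] = 2^{t-1}`
# for imaginary quadratic fields

Topic `NumberTheory/NumberFields`; namespace `Literature.NumberTheory.NumberFields.AmbiguousClass`.
Theorem-only file (no definition, no named fact); corollaries of the tree's Chevalley formula
(`AmbiguousClassNumberFormula.lean`, S. Lang, *Cyclotomic Fields I and II*, Ch. 13 §4 Lemma 4.1) over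
the base `ℚ` for a TOTALLY COMPLEX cyclic field `L`:

* `archFactor_rat_eq_two` — `e_∞(L/ℚ) = 2` (the place above `∞` is complex over real);
* `norm_pos_of_isTotallyComplex`, `unitsE_inf_map_norm_eq_bot`, `card_unitsE_inf_range_rat`,
  `relIndex_unitsNorm_eq_two` — norms from `L` are positive, so `E_ℚ ∩ N Lˣ = {1}` inside
  `E_ℚ = {±1}`: the unit index of Chevalley's formula is `2`;
* `relIndex_unitsNorm_dvd_two`, `relIndex_unitsNorm_eq_one_iff` — over `ℚ` the unit index is `1`
  or `2` according as `-1` is or is not a norm; `card_fixed_mul_finrank_mul_eq_finprod` — for `L/ℚ`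
  cyclic unramified at infinity (e.g. totally real) `#Cl(L)^G · [L:ℚ] · u = ∏_p e_p`;
  `card_fixed_mul_eq_pow_of_real_quadratic` — real quadratic: `#Cl(L)^G · u = 2^{t-1}`;
* **`card_fixed_mul_finrank_eq_finprod`** — hence **`#Cl(L)^G · [L:ℚ] = ∏_p e_p`** for every
  totally complex cyclic number field `L`;
* **`card_fixed_eq_pow_of_quadratic`** — for an IMAGINARY QUADRATIC field with `t` ramified
  primes: `t ≥ 1` and **`#Cl(L)^G = 2^{t-1}`**;
* `forall_smul_eq_iff_sq_eq_one` — for a quadratic field the non-trivial automorphism acts on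
  `Cl(L)` by inversion (`c · σc = i(N c) = 1` as `h_ℚ = 1`, `ClassGroupNormGalois.lean`), so the
  ambiguous classes are exactly the classes of order `≤ 2`;
* **`card_sq_eq_one_eq_pow_of_quadratic`** — **GAUSS'S GENUS THEOREM for imaginary quadratic
  fields: `#{c ∈ Cl(L) : c² = 1} = 2^{t-1}`**, `t` the number of ramified primes; in particular
  (`two_dvd_classNumber_of_quadratic`) `2 ∣ h_L` as soon as two primes ramify.

## References

* S. Lang, *Cyclotomic Fields I and II*, GTM 121 (1990), Ch. 13 §4, Lemma 4.1 (held copy,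
  PDF pp. 203–204). [Lang1990]
* G. Gras, *Class Field Theory* (2003), II.6.2.3, IV.4.2 (genus theory of quadratic fields). [Gras2003]
* D. A. Cox, *Primes of the form x² + ny²*, 2nd ed. (2013), §3.B Thm. 3.15, §6.A Thm. 6.1
  (genus theory: `#Cl(𝒪)[2] = 2^{μ-1}`). [Cox2013]
-/

noncomputable section

open NumberField NumberField.InfinitePlace IsDedekindDomain FractionalIdeal
open scoped nonZeroDivisors Pointwise

namespace Literature.NumberTheory.NumberFields.AmbiguousClass

open Literature.NumberTheory.GaloisRepresentations Literature.NumberTheory.GaloisRepresentations.Herbrand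
  Literature.NumberTheory.GaloisRepresentations.MinkowskiUnit
  Literature.NumberTheory.GaloisRepresentations.CyclicNormIndex
  Literature.NumberTheory.NumberFields.AmbiguousIdeal

variable {L : Type} [Field L] [NumberField L]

/-! ### The archimedean factor and the unit index over `ℚ` for a totally complex field -/

/-- **`e_∞(L/ℚ) = 2` for a totally complex Galois number field `L`**: the (unique) infinite place of
`ℚ` is real and the places of `L` above it are complex, so the decomposition group at infinity has
order `2`. [cite: Lang1990, Ch. 13 §4, before Lemma 4.1 ("if `v` is Archimedean, then `e(v) = 1` or `2`") (PDF p. 203)] -/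
theorem archFactor_rat_eq_two [IsGalois ℚ L] [IsTotallyComplex L] :
    ArchHerbrand.archFactor ℚ L = 2 := by
  unfold ArchHerbrand.archFactor
  rw [Fintype.prod_subsingleton _ Rat.infinitePlace,
    ← not_isUnramified_iff_card_stabilizer_eq_two, not_isUnramified_iff]
  refine ⟨IsTotallyComplex.isComplex _, ?_⟩
  rw [Subsingleton.elim ((ArchHerbrand.placeOver L Rat.infinitePlace).comap (algebraMap ℚ L))
    Rat.infinitePlace]
  exact Rat.isReal_infinitePlace

/-- **Norms from a totally complex field are positive**: `N_{L/ℚ}(x) > 0` for `x ≠ 0` (no real place,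
so the sign formula `N > 0 ⇔ #{w real : σ_w x < 0}` even, with the empty set).
[cite: Omeara1963, §71B Formula 71:11] -/
theorem norm_pos_of_isTotallyComplex [IsTotallyComplex L] {x : L} (hx : x ≠ 0) :
    0 < Algebra.norm ℚ x := by
  rw [QuadraticForms.norm_pos_iff_even_ncard hx]
  have h : {w : InfinitePlace L | ∃ hw : w.IsReal, embedding_of_isReal hw x < 0} = ∅ := by
    ext w
    simp only [Set.mem_setOf_eq, Set.mem_empty_iff_false, iff_false, not_exists]
    intro hw
    exact absurd hw (not_isReal_iff_isComplex.mpr (IsTotallyComplex.isComplex w))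
  rw [h, Set.ncard_empty]
  exact Even.zero

/-- `N_G = N_{L/ℚ}` on `Lˣ` (values): `(N_G y : L) = N_{L/ℚ}(y)` for `Gal(L/ℚ) = ⟨σ⟩`. [folklore] -/
private theorem coe_norm_eq_algebraMap_norm [IsGalois ℚ L] {σ : L ≃ₐ[ℚ] L}
    (hσ : ∀ τ : L ≃ₐ[ℚ] L, τ ∈ Subgroup.zpowers σ) (y : Lˣ) :
    ((Herbrand.norm (L ≃ₐ[ℚ] L) y : Lˣ) : L) = algebraMap ℚ L (Algebra.norm ℚ (y : L)) := by
  rw [← coe_normEnd_eq_algebraMap_norm hσ, normEnd_apply,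
    prod_range_card_pow_eq_prod hσ (fun g => g • y), ← norm_apply]

/-- **`E_ℚ ∩ N_{L/ℚ} Lˣ = {1}`** for a totally complex cyclic field `L` (`Gal = ⟨σ⟩`): a unit of `L`
lying in `ℚ` is `±1`, and `-1` is not a norm since norms are positive.
[cite: Lang1990, Ch. 13 §4, Lemma 4.1 (the index `(E_F : N_{K/F}K^* ∩ E_F)`) (PDF p. 203)] -/
theorem unitsE_inf_map_norm_eq_bot [IsGalois ℚ L] [IsTotallyComplex L] {σ : L ≃ₐ[ℚ] L}
    (hσ : ∀ τ : L ≃ₐ[ℚ] L, τ ∈ Subgroup.zpowers σ) :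
    unitsE L ⊓ (⊤ : Subgroup Lˣ).map (Herbrand.norm (L ≃ₐ[ℚ] L)) = ⊥ := by
  rw [eq_bot_iff]
  rintro x ⟨hxE, ⟨y, -, rfl⟩⟩
  rw [Subgroup.mem_bot]
  have hK : Herbrand.norm (L ≃ₐ[ℚ] L) y ∈ (unitsIncl ℚ L).range :=
    map_norm_top_le_range_unitsIncl hσ ⟨y, Subgroup.mem_top y, rfl⟩
  rcases eq_one_or_eq_neg_one_of_mem_unitsE_inf_range ⟨hxE, hK⟩ with h | h
  · exact h
  · exfalso
    have hpos := norm_pos_of_isTotallyComplex (L := L) (Units.ne_zero y)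
    have h2 : algebraMap ℚ L (Algebra.norm ℚ (y : L)) = algebraMap ℚ L (-1) := by
      rw [← coe_norm_eq_algebraMap_norm hσ, h, Units.val_neg, Units.val_one, map_neg, map_one]
    have h3 := (algebraMap ℚ L).injective h2
    linarith

/-- `-1 ∈ E_ℚ = 𝓞_Lˣ ∩ ℚˣ` (inside `Lˣ`). [folklore] -/
private theorem neg_one_mem_unitsE_inf_range : (-1 : Lˣ) ∈ unitsE L ⊓ (unitsIncl ℚ L).range := by
  refine ⟨mem_unitsE_iff.mpr ⟨-1, ?_⟩, ⟨-1, ?_⟩⟩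
  · ext
    rw [Units.coe_map, MonoidHom.coe_coe, Units.val_neg, Units.val_one, map_neg, map_one,
      Units.val_neg, Units.val_one]
  · ext
    rw [coe_unitsIncl, Units.val_neg, Units.val_one, map_neg, map_one, Units.val_neg,
      Units.val_one]

/-- **`E_ℚ = {±1}` has order `2`** (as the units of `L` lying in `ℚ`, inside `Lˣ`).
[cite: NeukirchANT1999, Ch. I §2 (ℤ is integrally closed; `ℤˣ = {±1}`)] -/
theorem card_unitsE_inf_range_rat :
    Nat.card (unitsE L ⊓ (unitsIncl ℚ L).range : Subgroup Lˣ) = 2 := by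
  have heq : unitsE L ⊓ (unitsIncl ℚ L).range = Subgroup.zpowers (-1 : Lˣ) := by
    apply le_antisymm
    · intro x hx
      rcases eq_one_or_eq_neg_one_of_mem_unitsE_inf_range hx with rfl | rfl
      · exact Subgroup.one_mem _
      · exact Subgroup.mem_zpowers _
    · rw [Subgroup.zpowers_le]
      exact neg_one_mem_unitsE_inf_range
  have hne : (-1 : Lˣ) ≠ 1 := by
    intro h
    have h' : ((-1 : Lˣ) : L) = ((1 : Lˣ) : L) := by rw [h]
    rw [Units.val_neg, Units.val_one] at h'
    norm_num at h'
  rw [heq, Nat.card_zpowers, orderOf_eq_prime (p := 2) (by rw [neg_one_sq]) hne]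

/-- **The unit index of Chevalley's formula is `2`** for a totally complex cyclic field `L/ℚ`:
`[E_ℚ : E_ℚ ∩ N Lˣ] = [{±1} : {1}] = 2`. [cite: Lang1990, Ch. 13 §4, Lemma 4.1 (PDF p. 203)] -/
theorem relIndex_unitsNorm_eq_two [IsGalois ℚ L] [IsTotallyComplex L] {σ : L ≃ₐ[ℚ] L}
    (hσ : ∀ τ : L ≃ₐ[ℚ] L, τ ∈ Subgroup.zpowers σ) :
    (unitsE L ⊓ (⊤ : Subgroup Lˣ).map (Herbrand.norm (L ≃ₐ[ℚ] L))).relIndex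
        (unitsE L ⊓ (unitsIncl ℚ L).range) = 2 := by
  rw [unitsE_inf_map_norm_eq_bot hσ, Subgroup.relIndex_bot_left, card_unitsE_inf_range_rat]

/-- **The unit index of Chevalley's formula over `ℚ` divides `2`** (`E_ℚ = {±1}`).
[cite: Lang1990, Ch. 13 §4, Lemma 4.1 (PDF p. 203)] -/
theorem relIndex_unitsNorm_dvd_two [IsGalois ℚ L] :
    (unitsE L ⊓ (⊤ : Subgroup Lˣ).map (Herbrand.norm (L ≃ₐ[ℚ] L))).relIndex
        (unitsE L ⊓ (unitsIncl ℚ L).range) ∣ 2 := by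
  rw [← card_unitsE_inf_range_rat (L := L)]
  exact Subgroup.relIndex_dvd_card _ _

/-- **The unit index over `ℚ` is `1` iff `-1` is a norm**: `[E_ℚ : E_ℚ ∩ N_G Lˣ] = 1 ↔ -1 ∈ N_G(Lˣ)`.
[cite: Lang1990, Ch. 13 §4, Lemma 4.1 (PDF p. 203)] -/
theorem relIndex_unitsNorm_eq_one_iff [IsGalois ℚ L] :
    (unitsE L ⊓ (⊤ : Subgroup Lˣ).map (Herbrand.norm (L ≃ₐ[ℚ] L))).relIndex
        (unitsE L ⊓ (unitsIncl ℚ L).range) = 1 ↔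
      (-1 : Lˣ) ∈ (⊤ : Subgroup Lˣ).map (Herbrand.norm (L ≃ₐ[ℚ] L)) := by
  rw [Subgroup.relIndex_eq_one]
  constructor
  · intro h
    exact (h neg_one_mem_unitsE_inf_range).2
  · intro h x hx
    refine ⟨hx.1, ?_⟩
    rcases eq_one_or_eq_neg_one_of_mem_unitsE_inf_range hx with rfl | rfl
    · exact Subgroup.one_mem _
    · exact h

/-! ### Cyclic fields unramified at infinity (e.g. totally real) -/

/-- `e_∞(L/ℚ) = 1` for a totally real Galois number field `L`. [cite: Lang1990, Ch. 13 §4, before Lemma 4.1 (PDF p. 203)] -/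
theorem archFactor_rat_eq_one_of_isTotallyReal [IsGalois ℚ L] [IsTotallyReal L] :
    ArchHerbrand.archFactor ℚ L = 1 := by
  haveI : IsUnramifiedAtInfinitePlaces ℚ L :=
    ⟨fun w => isUnramified_iff.mpr (Or.inl (IsTotallyReal.isReal w))⟩
  exact archFactor_eq_one

/-- **`#Cl(L)^G · [L:ℚ] · u = ∏_p e_p` for a cyclic number field `L/ℚ` unramified at infinity**
(e.g. totally real, or of odd degree), `Gal(L/ℚ) = ⟨σ⟩`, where the unit index
`u = [E_ℚ : E_ℚ ∩ N Lˣ]` is `1` or `2` according as `-1` is or is not a norm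
(`relIndex_unitsNorm_eq_one_iff`, `relIndex_unitsNorm_dvd_two`).
[cite: Lang1990, Ch. 13 §4, Lemma 4.1 (PDF p. 203)] [cite: Gras2003, II.6.2.3] -/
theorem card_fixed_mul_finrank_mul_eq_finprod [IsGalois ℚ L] [IsUnramifiedAtInfinitePlaces ℚ L]
    {σ : L ≃ₐ[ℚ] L} (hσ : ∀ τ : L ≃ₐ[ℚ] L, τ ∈ Subgroup.zpowers σ) :
    Nat.card {c : ClassGroup (𝓞 L) // ∀ τ : L ≃ₐ[ℚ] L, ClassGroup.mulEquiv (intAut τ) c = c} *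
        Module.finrank ℚ L *
        (unitsE L ⊓ (⊤ : Subgroup Lˣ).map (Herbrand.norm (L ≃ₐ[ℚ] L))).relIndex
          (unitsE L ⊓ (unitsIncl ℚ L).range) =
      ∏ᶠ p : HeightOneSpectrum (𝓞 ℚ), p.asIdeal.ramificationIdxIn (𝓞 L) := by
  have h := ambiguousClassNumberFormula hσ
  rwa [archFactor_eq_one, Rat.classNumber_eq, one_mul, mul_one] at h

/-- **Real quadratic fields: `#Cl(L)^G · u = 2^{t-1}`** with `t ≥ 1` ramified primes and `u = 1` or
`2` according as `-1` is or is not a norm from `L`. [cite: Cox2013, §6.A Thm. 6.1] [cite: Gras2003, IV.4.2] -/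
theorem card_fixed_mul_eq_pow_of_real_quadratic [IsTotallyReal L] (h2 : Module.finrank ℚ L = 2)
    {σ : L ≃ₐ[ℚ] L} (hσ : ∀ τ : L ≃ₐ[ℚ] L, τ ∈ Subgroup.zpowers σ) :
    1 ≤ {p : HeightOneSpectrum (𝓞 ℚ) | p.asIdeal.ramificationIdxIn (𝓞 L) ≠ 1}.ncard ∧
    Nat.card {c : ClassGroup (𝓞 L) // ∀ τ : L ≃ₐ[ℚ] L, ClassGroup.mulEquiv (intAut τ) c = c} *
        (unitsE L ⊓ (⊤ : Subgroup Lˣ).map (Herbrand.norm (L ≃ₐ[ℚ] L))).relIndex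
          (unitsE L ⊓ (unitsIncl ℚ L).range) =
      2 ^ ({p : HeightOneSpectrum (𝓞 ℚ) | p.asIdeal.ramificationIdxIn (𝓞 L) ≠ 1}.ncard - 1) := by
  classical
  haveI : Algebra.IsQuadraticExtension ℚ L := { finrank_eq_two' := h2 }
  haveI : IsUnramifiedAtInfinitePlaces ℚ L :=
    ⟨fun w => isUnramified_iff.mpr (Or.inl (IsTotallyReal.isReal w))⟩
  have h := card_fixed_mul_finrank_mul_eq_finprod hσ
  rw [h2, finprod_ramificationIdxIn_eq_pow_of_prime Nat.prime_two h2] at h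
  set t := {p : HeightOneSpectrum (𝓞 ℚ) | p.asIdeal.ramificationIdxIn (𝓞 L) ≠ 1}.ncard with ht
  set c := Nat.card {c : ClassGroup (𝓞 L) // ∀ τ : L ≃ₐ[ℚ] L, ClassGroup.mulEquiv (intAut τ) c = c}
    with hc
  set u := (unitsE L ⊓ (⊤ : Subgroup Lˣ).map (Herbrand.norm (L ≃ₐ[ℚ] L))).relIndex
      (unitsE L ⊓ (unitsIncl ℚ L).range) with hu
  have ht1 : 1 ≤ t := by
    by_contra h0
    have ht0 : t = 0 := by omega
    rw [ht0, pow_zero] at h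
    have : 2 ∣ 1 := ⟨c * u, by rw [← h]; ring⟩
    omega
  refine ⟨ht1, ?_⟩
  have hpow : 2 ^ t = 2 ^ (t - 1) * 2 := by
    rw [← pow_succ, Nat.sub_one_add_one_eq_of_pos ht1]
  rw [hpow, mul_right_comm] at h
  exact Nat.eq_of_mul_eq_mul_right two_pos h

/-! ### Totally complex cyclic fields -/

/-- **`#Cl(L)^G · [L : ℚ] = ∏_p e_p` for a totally complex cyclic number field `L`** with
`Gal(L/ℚ) = ⟨σ⟩` (Chevalley's formula with `h_ℚ = 1`, unit index `2` and `e_∞ = 2`).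
[cite: Lang1990, Ch. 13 §4, Lemma 4.1 (PDF p. 203)] [cite: Gras2003, II.6.2.3] -/
theorem card_fixed_mul_finrank_eq_finprod [IsGalois ℚ L] [IsTotallyComplex L] {σ : L ≃ₐ[ℚ] L}
    (hσ : ∀ τ : L ≃ₐ[ℚ] L, τ ∈ Subgroup.zpowers σ) :
    Nat.card {c : ClassGroup (𝓞 L) // ∀ τ : L ≃ₐ[ℚ] L, ClassGroup.mulEquiv (intAut τ) c = c} *
        Module.finrank ℚ L =
      ∏ᶠ p : HeightOneSpectrum (𝓞 ℚ), p.asIdeal.ramificationIdxIn (𝓞 L) := by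
  have h := ambiguousClassNumberFormula hσ
  rw [relIndex_unitsNorm_eq_two hσ, archFactor_rat_eq_two, Rat.classNumber_eq, one_mul] at h
  exact Nat.eq_of_mul_eq_mul_right two_pos h

/-! ### Imaginary quadratic fields -/

/-- **`#Cl(L)^G = 2^{t-1}` for an imaginary quadratic field `L` with `t` ramified primes** (and
`t ≥ 1`). [cite: Lang1990, Ch. 13 §4, Lemma 4.1 (PDF p. 203)] [cite: Cox2013, §6.A Thm. 6.1] -/
theorem card_fixed_eq_pow_of_quadratic [IsTotallyComplex L] (h2 : Module.finrank ℚ L = 2) :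
    1 ≤ {p : HeightOneSpectrum (𝓞 ℚ) | p.asIdeal.ramificationIdxIn (𝓞 L) ≠ 1}.ncard ∧
    Nat.card {c : ClassGroup (𝓞 L) // ∀ τ : L ≃ₐ[ℚ] L, ClassGroup.mulEquiv (intAut τ) c = c} =
      2 ^ ({p : HeightOneSpectrum (𝓞 ℚ) | p.asIdeal.ramificationIdxIn (𝓞 L) ≠ 1}.ncard - 1) := by
  classical
  haveI : Algebra.IsQuadraticExtension ℚ L := { finrank_eq_two' := h2 }
  obtain ⟨σ, hσ⟩ := IsCyclic.exists_generator (α := L ≃ₐ[ℚ] L)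
  have h := card_fixed_mul_finrank_eq_finprod hσ
  rw [h2, finprod_ramificationIdxIn_eq_pow_of_prime Nat.prime_two h2] at h
  set t := {p : HeightOneSpectrum (𝓞 ℚ) | p.asIdeal.ramificationIdxIn (𝓞 L) ≠ 1}.ncard with ht
  set c := Nat.card {c : ClassGroup (𝓞 L) // ∀ τ : L ≃ₐ[ℚ] L, ClassGroup.mulEquiv (intAut τ) c = c}
    with hc
  have ht1 : 1 ≤ t := by
    by_contra h0
    have ht0 : t = 0 := by omega
    rw [ht0, pow_zero] at h
    have : 2 ∣ 1 := ⟨c, by rw [← h, mul_comm]⟩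
    omega
  refine ⟨ht1, ?_⟩
  have hpow : 2 ^ t = 2 ^ (t - 1) * 2 := by
    rw [← pow_succ, Nat.sub_one_add_one_eq_of_pos ht1]
  rw [hpow] at h
  exact Nat.eq_of_mul_eq_mul_right two_pos h

/-- **In a quadratic field the ambiguous classes are the classes of order `≤ 2`**: the non-trivial
automorphism `σ` acts on `Cl(L)` by inversion (`c · σc = i_{L/ℚ}(N c) = 1` since `h_ℚ = 1`), so
`σ c = c ⟺ c² = 1`. [cite: Cox2013, §3.B Thm. 3.15 and §6.A (proof of Thm. 6.1)] [cite: NeukirchANT1999, Ch. III §1 Prop. (1.6) (iv)] -/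
theorem forall_smul_eq_iff_sq_eq_one (h2 : Module.finrank ℚ L = 2) (c : ClassGroup (𝓞 L)) :
    (∀ τ : L ≃ₐ[ℚ] L, ClassGroup.mulEquiv (intAut τ) c = c) ↔ c ^ 2 = 1 := by
  classical
  haveI : Algebra.IsQuadraticExtension ℚ L := { finrank_eq_two' := h2 }
  have hcard : Fintype.card (L ≃ₐ[ℚ] L) = 2 := by
    rw [← Nat.card_eq_fintype_card, IsGalois.card_aut_eq_finrank, h2]
  constructor
  · intro hc
    rw [← h2]
    exact pow_finrank_eq_one_of_forall_smul_eq ℚ L Rat.classNumber_eq hc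
  · intro hc2 τ
    by_cases hτ : τ = 1
    · rw [hτ, mulEquiv_intAut_one, MulEquiv.refl_apply]
    · have huniv : ({1, τ} : Finset (L ≃ₐ[ℚ] L)) = Finset.univ :=
        Finset.eq_univ_of_card _ (by rw [Finset.card_pair (Ne.symm hτ), hcard])
      have hprod := prod_galois_smul_eq_one_of_card_classGroup_eq_one ℚ L Rat.classNumber_eq c
      rw [← huniv, Finset.prod_pair (Ne.symm hτ), mulEquiv_intAut_one, MulEquiv.refl_apply] at hprod
      -- `hprod : c * τ c = 1`, and `c * c = 1`
      rw [pow_two] at hc2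
      rw [eq_inv_of_mul_eq_one_right hprod, inv_eq_of_mul_eq_one_right hc2]

/-- **GAUSS'S GENUS THEOREM (imaginary quadratic fields): `#{c ∈ Cl(L) : c² = 1} = 2^{t-1}`**, where
`t ≥ 1` is the number of primes ramified in the imaginary quadratic field `L` — the classes of order
`≤ 2` (the ambiguous classes) number `2^{t-1}`, i.e. the `2`-rank of `Cl(L)` is `t − 1`.
[cite: Cox2013, §6.A Thm. 6.1 with §3.B Thm. 3.15] [cite: Gras2003, IV.4.2] -/
theorem card_sq_eq_one_eq_pow_of_quadratic [IsTotallyComplex L] (h2 : Module.finrank ℚ L = 2) :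
    1 ≤ {p : HeightOneSpectrum (𝓞 ℚ) | p.asIdeal.ramificationIdxIn (𝓞 L) ≠ 1}.ncard ∧
    Nat.card {c : ClassGroup (𝓞 L) // c ^ 2 = 1} =
      2 ^ ({p : HeightOneSpectrum (𝓞 ℚ) | p.asIdeal.ramificationIdxIn (𝓞 L) ≠ 1}.ncard - 1) := by
  obtain ⟨ht, hc⟩ := card_fixed_eq_pow_of_quadratic (L := L) h2
  refine ⟨ht, ?_⟩
  rw [← hc]
  exact Nat.card_congr (Equiv.subtypeEquivRight fun c => (forall_smul_eq_iff_sq_eq_one h2 c).symm)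

/-- **`2^{t-1} ∣ h_L`** for an imaginary quadratic field `L` with `t` ramified primes; in particular
`h_L` is even as soon as two primes ramify. [cite: Cox2013, §6.A Thm. 6.1] [cite: Gras2003, IV.4.2] -/
theorem pow_dvd_classNumber_of_quadratic [IsTotallyComplex L] (h2 : Module.finrank ℚ L = 2) :
    2 ^ ({p : HeightOneSpectrum (𝓞 ℚ) | p.asIdeal.ramificationIdxIn (𝓞 L) ≠ 1}.ncard - 1) ∣
      classNumber L := by
  rw [← (card_fixed_eq_pow_of_quadratic (L := L) h2).2]
  exact card_fixed_dvd_classNumber (K := ℚ)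

/-- `2 ∣ h_L` for an imaginary quadratic field in which at least two primes ramify.
[cite: Cox2013, §6.A Thm. 6.1] -/
theorem two_dvd_classNumber_of_quadratic [IsTotallyComplex L] (h2 : Module.finrank ℚ L = 2)
    (ht : 2 ≤ {p : HeightOneSpectrum (𝓞 ℚ) | p.asIdeal.ramificationIdxIn (𝓞 L) ≠ 1}.ncard) :
    2 ∣ classNumber L :=
  (dvd_pow_self 2 (by omega)).trans (pow_dvd_classNumber_of_quadratic h2)

end Literature.NumberTheory.NumberFields.AmbiguousClass

end
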